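import Summits.QuantumFields.BalabanUV.T4Continuum.Support.NE7EtaRegularGaugeInvariance
import Literature.MathematicalPhysics.QuantumFieldTheory.Balaban1983to89.T4OutputRate

/-!
# NE7EtaBackgroundCarrier — route #1 of the NE7 crux, stub S7 (NODE O, the BACKGROUND COORDINATE): the carrier INSTANCE in route 1's
# vocabulary — ONE `T4OutputRate.Carriers` hosting all cutoffs on LEVEL-TAGGED SUBTYPES of lattice configurations, with the
# level-weighted PLAIN (1.13) max-reading as its gauge and one block averaging as its transport (bill (G5) items (1), (2), (6))

Cell `pub-balaban`, rung (B)+1 sub-cell t4, lineage `b2b-balaban-t4-ne7-p1`, generation 25 (CRUX PROVER NE7 #1, ruling e34b3e0c); crux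
skeleton `t4/skeletons/NE7-CRUX-R1.md` v1.7.4 §3quinquies ∕ §5 (G5); question Q-ne7p1-g24-1 answered GO-AMENDED by the crux refuter
(PRICING-NE7 v8 draft, F32; HOME/INBOX [NE7REF-G8-INBOX]); sequel of `NE7EtaPlainGradientLetters` (p256062), `NE7EtaMinimiserGaugeCovariance`
(p256168), `NE7EtaSmoothGaugeTransport` (p256456), `NE7EtaRegularGaugeInvariance` (p256795).  HONEST FRAMING (page 1): FIXED FINITE T⁴, rung
(B)+1; NE7, NE3 NOT PRINTED in [Balaban1984PropagatorsI]–[Balaban1989LargeFieldII] and NOT PROVED here; continuum YM on T⁴ ⇐ BetaPertH ∧ nine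
spine estimates (0/9 proved); BetaPertH ⇐ (D1) ∧ (D4) ∧ CAP+tail; G-an2-4 gates asym, D1 and NE2/3/4; NOT infinite volume, NOT mass gap, NOT
Clay.

WHAT (definitions + [folklore] bookkeeping; the closeness theorem on this carrier is the companion `NE7EtaBackgroundCloseness`).
 * §1 `supVal`, `supGrad`, `reading`, `plainReading`, `levelGauge` — the level-`k` weighted PLAIN reading of a pair of configurations on `ℤ⁴`:
   `plainReading L N k U U' = max (L^k · sup_{b ∈ periodBox (N L^k) × 4} ‖U_b − U'_b‖) ((L^k)² · sup_{x ∈ periodBox, μ, κ} ‖∇_μ(U − U')(x, κ)‖)`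
   (`Real.iSup` over the finite bond set; gradient = the PLAIN forward difference `F(x + e_μ, κ) − F(x, κ)`, NOT the covariant one), i.e. the
   two-radius box (1.13) p. 262 of [Balaban1987RG1] read in field units `ξ = L^{−k}`: potential weight `ξ⁻¹`, gradient weight `ξ⁻²` (located
   constraint (F1) of p256062: T.2's embedding socket needs BOTH parts).  On level-tagged configurations `levelGauge L N (k, U) (k', U')` is
   the plain reading when `k = k'` and the SUM of the two tagged sizes `reading k U + reading k' U'` otherwise — so that any later
   `ℓ^∞`∕`ℓ¹` direct sum over levels of the graded (value, gradient) restriction maps is dominated by the gauge (T.2's `hgauge`), level by level.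
   `reading_le`, `plainReading_le_rate`: pointwise letters `≤ A·θ^{8k}` (values) and `≤ C_G·θ^{13k}` (plain gradients) give
   `plainReading ≤ (A + C_G)·θ^k` (`NE7EtaPlainGradientLetters.plain_reading_le` through `L^k = θ^{−6k}`).
 * §2 `bgCarriers` — the `Carriers` instance: `Dom, scale, d` ABSTRACT PARAMETERS (O1-a's torus catalogue `B13Carriers` or any other plugs in;
   NE5's ENDs `Spine/NE5/LeafIndex.ne5_of_leaves*` and `T4OutputRate.NE9` are generic in the carrier, so no sibling row is bound);
   `BgA = {(k, U) // U ∈ admA k}`, `BgB = {(k, U) // U ∈ admB k}` for CLASS PARAMETERS `admA admB : ℕ → Set cfg` with the `mapsTo` binder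
   `U ∈ admB k → rescale L (bavg L U) ∈ admA k` ((G5) item (6), [Balaban1985Averaging] Prop. 1 TYPE — a hypothesis of the instancer, discharged
   trivially for the OCCURRING classes of §4); `gauge = levelGauge` on the tags∕values; `transport (k, U) = (k, rescale L (bavg L U))` (the tag is
   the run-A cutoff `K` the run-B background is paired with; run B's lattice is the `N·L^{K+1}` one).
 * §3 small lemmas (`pow_level_eq`, `theta_lt_one`, `isPeriodicSite_corner`, `gaugeAct_mul'`, `isUnitarySite_mul`, `isPeriodicSite_mul`).
 * §4 `occB`, `occA`, `occCarriers` — the CANONICAL classes «backgrounds that OCCUR»: the trivial background, the minimisers of the runs for data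
   of `dom` (class `MinimalActionRate.sfClass`), and (run A) the transports of run B's; the five class binders of the closeness theorem hold by
   construction (`one_mem_occA`, `one_mem_occB`, `rescale_bavg_mem_occA`, `minimiser_mem_occA`, `minimiser_mem_occB`).
LOCATED (gen 25, design level) **(F4)**: T.2 `TermwiseAnalyticMarginLayered.lipBackground_of_layeredMargin` quantifies its creation margin
`hcreate : ∀ U : C.BgA, closedBall (ι U) (ϱ₀ g j) ⊆ Dch g X 0`, its bound `hbd0` and its realness `hreal` over ALL of `C.BgA`.  Were `BgA` ALL
unit-valued configurations, the analytic extension `Ec g X 0` would be defined and bounded by `E₀e^{−κd}` on a `ϱ₀`-tube around the graded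
restrictions of every configuration — on the value coordinates an ENTIRE bounded function, hence CONSTANT (Liouville): `LipBackground` would
hold only for functionals constant in the background.  So route 1's `BgA` must be cut out by a regularity class of backgrounds that OCCUR
((1.2) p. 260 of [Balaban1987RG1] TYPE: *"configurations belonging to the space U_k(ε₀)"*) — hence the subtypes of §2 and the classes of §4.
HONEST.  Definitions and bookkeeping only; NO estimate; nothing of [Balaban1985Averaging]–[Balaban1988Convergent] asserted; the carrier is OUR
object (cell modelling under the LEAN PLACEMENT RULE), not a printed one; 0 sorry.
-/

set_option autoImplicit false

open scoped BigOperators Matrix Matrix.Norms.L2Operator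
open Finset NormedSpace

namespace Summit.QuantumFields.BalabanUV.T4Continuum.NE7EtaBackgroundCarrier

open Literature.MathematicalPhysics.QuantumFieldTheory.Balaban1983to89
open B7Prop1Explicit B7Prop2Explicit
open T4AveragingDeficitWall hiding Site Plane Plaq Bond
open T4AveragingDeficitWallBoundary (periodBox IsPeriodicCfg)
open T4OutputRate (Carriers)
open AveragingDeficitPeriodicCounting (IsPeriodicDir)
open AveragingDeficitMultiLevelPrep (LevelSmall)
open MinimalActionSandwich (IsMinimiser)
open MinimalActionRate (Regular sfClass)
open NE3EnergyShapes (residualScale IsUnitarySite IsPeriodicSite)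
open NE3EnergyWeightedShapes (energyNormW)
open AveragingDeficitDualResidual (dualC1 dualC2)
open AveragingDeficitDerivWallProof (wallConst)

noncomputable section

variable {n : Type} [Fintype n] [DecidableEq n]

/-! ## §1 The level-weighted PLAIN (1.13) reading -/

/-- The sup of the bond values `‖F b‖` of a matrix-valued bond function over the bonds based in the finite site set `S` (`Real.iSup` over the
finite index `S × Fin 4`; `0` if `S = ∅`). [folklore] -/
def supVal (S : Finset (Site 4)) (F : Site 4 → Fin 4 → Matrix n n ℂ) : ℝ :=
  ⨆ b : S × Fin 4, ‖F (b.1 : Site 4) b.2‖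

/-- The sup of the PLAIN forward differences `‖F (x + e_μ, κ) − F (x, κ)‖` over `x ∈ S`, `μ κ : Fin 4` (the neighbour `x + e_μ` may leave `S`;
for `S` a period box and periodic `F` this is the sup over the torus). [folklore] -/
def supGrad (S : Finset (Site 4)) (F : Site 4 → Fin 4 → Matrix n n ℂ) : ℝ :=
  ⨆ t : S × Fin 4 × Fin 4, ‖F ((t.1 : Site 4) + e t.2.1) t.2.2 - F (t.1 : Site 4) t.2.2‖

/-- **THE LEVEL-`k` WEIGHTED READING** of a matrix-valued bond function: `max (L^k · supVal) ((L^k)² · supGrad)` over the period box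
`periodBox (N·L^k)` — the two-radius box (1.13) p. 262 of [Balaban1987RG1] (`|U − 1| < α₀ξ`, `|∇U| < α₁ξ²`, `ξ = L^{−k}`) turned into ONE
max-norm in field units (our packaging; the printed object is the pair of radii, context only). [folklore] -/
def reading (L N k : ℕ) (F : Site 4 → Fin 4 → Matrix n n ℂ) : ℝ :=
  max ((L : ℝ) ^ k * supVal (periodBox (N * L ^ k)) F) (((L : ℝ) ^ k) ^ 2 * supGrad (periodBox (N * L ^ k)) F)

/-- The bondwise matrix values of a configuration. [folklore] -/
def valCfg (U : Site 4 → Fin 4 → (Matrix n n ℂ)ˣ) : Site 4 → Fin 4 → Matrix n n ℂ :=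
  fun x κ => ((U x κ : (Matrix n n ℂ)ˣ) : Matrix n n ℂ)

/-- The bondwise matrix difference `U_b − U'_b` of two configurations. [folklore] -/
def diffCfg (U U' : Site 4 → Fin 4 → (Matrix n n ℂ)ˣ) : Site 4 → Fin 4 → Matrix n n ℂ :=
  fun x κ => ((U x κ : (Matrix n n ℂ)ˣ) : Matrix n n ℂ) - ((U' x κ : (Matrix n n ℂ)ˣ) : Matrix n n ℂ)

/-- **THE PLAIN READING OF A PAIR AT LEVEL `k`**: `reading L N k (U − U')`. [folklore] -/
def plainReading (L N k : ℕ) (U U' : Site 4 → Fin 4 → (Matrix n n ℂ)ˣ) : ℝ := reading L N k (diffCfg U U')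

/-- **THE GAUGE ON LEVEL-TAGGED CONFIGURATIONS**: the plain reading on same-level pairs; across levels the SUM of the two tagged sizes
(dominates the distance of the graded restrictions in any `ℓ^∞`∕`ℓ¹` direct sum over levels — T.2's `hgauge` for a later embedding `ι`;
never evaluated by the tower composition, whose pairs are same-level by construction). [folklore] -/
def levelGauge (L N : ℕ) (p q : ℕ × (Site 4 → Fin 4 → (Matrix n n ℂ)ˣ)) : ℝ :=
  if p.1 = q.1 then plainReading L N p.1 p.2 q.2 else reading L N p.1 (valCfg p.2) + reading L N q.1 (valCfg q.2)

/-- `0 ≤ supVal`. [folklore] -/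
theorem supVal_nonneg (S : Finset (Site 4)) (F : Site 4 → Fin 4 → Matrix n n ℂ) : 0 ≤ supVal S F :=
  Real.iSup_nonneg fun _ => norm_nonneg _

/-- `0 ≤ supGrad`. [folklore] -/
theorem supGrad_nonneg (S : Finset (Site 4)) (F : Site 4 → Fin 4 → Matrix n n ℂ) : 0 ≤ supGrad S F :=
  Real.iSup_nonneg fun _ => norm_nonneg _

/-- `0 ≤ reading`. [folklore] -/
theorem reading_nonneg (L N k : ℕ) (F : Site 4 → Fin 4 → Matrix n n ℂ) : 0 ≤ reading L N k F :=
  le_max_of_le_left (mul_nonneg (by positivity) (supVal_nonneg _ _))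

/-- `0 ≤ levelGauge` (the `gauge_nonneg` field of the carrier). [folklore] -/
theorem levelGauge_nonneg (L N : ℕ) (p q : ℕ × (Site 4 → Fin 4 → (Matrix n n ℂ)ˣ)) : 0 ≤ levelGauge L N p q := by
  unfold levelGauge plainReading
  split_ifs
  · exact reading_nonneg _ _ _ _
  · exact add_nonneg (reading_nonneg _ _ _ _) (reading_nonneg _ _ _ _)

/-- `supVal ≤ D` from a pointwise bound `‖F x κ‖ ≤ D` on `S` (`D ≥ 0`). [folklore] -/
theorem supVal_le {S : Finset (Site 4)} {F : Site 4 → Fin 4 → Matrix n n ℂ} {D : ℝ} (hD : 0 ≤ D)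
    (h : ∀ x ∈ S, ∀ κ, ‖F x κ‖ ≤ D) : supVal S F ≤ D :=
  Real.iSup_le (fun b => h b.1 b.1.2 b.2) hD

/-- `supGrad ≤ G` from a pointwise bound on the plain forward differences based in `S` (`G ≥ 0`). [folklore] -/
theorem supGrad_le {S : Finset (Site 4)} {F : Site 4 → Fin 4 → Matrix n n ℂ} {G : ℝ} (hG : 0 ≤ G)
    (h : ∀ x ∈ S, ∀ μ κ, ‖F (x + e μ) κ - F x κ‖ ≤ G) : supGrad S F ≤ G :=
  Real.iSup_le (fun t => h t.1 t.1.2 t.2.1 t.2.2) hG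

/-- **THE READING FROM POINTWISE LETTERS**: values `≤ D` and plain gradients `≤ G` on the period box give
`reading L N k F ≤ max (L^k·D) ((L^k)²·G)`. [folklore] -/
theorem reading_le {L N k : ℕ} {F : Site 4 → Fin 4 → Matrix n n ℂ} {D G : ℝ} (hD : 0 ≤ D) (hG : 0 ≤ G)
    (hv : ∀ x ∈ periodBox (d := 4) (N * L ^ k), ∀ κ, ‖F x κ‖ ≤ D)
    (hg : ∀ x ∈ periodBox (d := 4) (N * L ^ k), ∀ μ κ, ‖F (x + e μ) κ - F x κ‖ ≤ G) :
    reading L N k F ≤ max ((L : ℝ) ^ k * D) (((L : ℝ) ^ k) ^ 2 * G) :=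
  max_le_max (mul_le_mul_of_nonneg_left (supVal_le hD hv) (by positivity))
    (mul_le_mul_of_nonneg_left (supGrad_le hG hg) (by positivity))

/-! ## §2 The carrier -/

variable (n) in
/-- **THE BACKGROUND-COORDINATE CARRIER OF ROUTE #1** (bill (G5) items (1), (2), (6); module docstring §2): domains∕scale∕tree length
abstract; run-A and run-B backgrounds = level-tagged configurations `Site 4 → Fin 4 → U(n)` in the classes `admA`, `admB`; gauge = the
level-weighted plain (1.13) reading; transport = one block averaging read on run A's lattice, `(k, U) ↦ (k, rescale L (bavg L U))`
([Balaban1985Averaging] (42), tree `B7Prop1Explicit.bavg`), kept in the class by the `mapsTo` binder `hmaps`.  OUR object (cell modelling);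
nothing printed is asserted. [folklore] -/
def bgCarriers [Nonempty n] (L N : ℕ) (D : Type) (sc : D → ℕ) (dl : D → ℝ) (hdl : ∀ X, 0 ≤ dl X)
    (admA admB : ℕ → Set (Site 4 → Fin 4 → (Matrix n n ℂ)ˣ))
    (hmaps : ∀ (k : ℕ) (U : Site 4 → Fin 4 → (Matrix n n ℂ)ˣ), U ∈ admB k → rescale L (bavg L U) ∈ admA k) : Carriers where
  Dom := D
  scale := sc
  d := dl
  d_nonneg := hdl
  BgA := {p : ℕ × (Site 4 → Fin 4 → (Matrix n n ℂ)ˣ) // p.2 ∈ admA p.1}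
  BgB := {p : ℕ × (Site 4 → Fin 4 → (Matrix n n ℂ)ˣ) // p.2 ∈ admB p.1}
  gauge := fun U U' => levelGauge L N U.1 U'.1
  gauge_nonneg := fun U U' => levelGauge_nonneg L N U.1 U'.1
  transport := fun U => ⟨(U.1.1, rescale L (bavg L U.1.2)), hmaps U.1.1 U.1.2 U.2⟩


/-- The gauge of the carrier is the level gauge of the underlying tagged configurations. [folklore] -/
theorem bgCarriers_gauge [Nonempty n] {L N : ℕ} {D : Type} {sc : D → ℕ} {dl : D → ℝ} {hdl : ∀ X, 0 ≤ dl X}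
    {admA admB : ℕ → Set (Site 4 → Fin 4 → (Matrix n n ℂ)ˣ)}
    {hmaps : ∀ (k : ℕ) (U : Site 4 → Fin 4 → (Matrix n n ℂ)ˣ), U ∈ admB k → rescale L (bavg L U) ∈ admA k}
    (U U' : (bgCarriers n L N D sc dl hdl admA admB hmaps).BgA) :
    (bgCarriers n L N D sc dl hdl admA admB hmaps).gauge U U' = levelGauge L N U.1 U'.1 := rfl

/-- The transport of the carrier keeps the tag and averages once. [folklore] -/
theorem bgCarriers_transport_val [Nonempty n] {L N : ℕ} {D : Type} {sc : D → ℕ} {dl : D → ℝ} {hdl : ∀ X, 0 ≤ dl X}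
    {admA admB : ℕ → Set (Site 4 → Fin 4 → (Matrix n n ℂ)ˣ)}
    {hmaps : ∀ (k : ℕ) (U : Site 4 → Fin 4 → (Matrix n n ℂ)ˣ), U ∈ admB k → rescale L (bavg L U) ∈ admA k}
    (U : (bgCarriers n L N D sc dl hdl admA admB hmaps).BgB) :
    ((bgCarriers n L N D sc dl hdl admA admB hmaps).transport U).1 = (U.1.1, rescale L (bavg L U.1.2)) := rfl

/-- Same-level pairs are read by the plain reading. [folklore] -/
theorem levelGauge_same (L N k : ℕ) (U U' : Site 4 → Fin 4 → (Matrix n n ℂ)ˣ) :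
    levelGauge L N (k, U) (k, U') = plainReading L N k U U' := if_pos rfl

/-! ## §3 Small lemmas: the level weight, corner periodicity, composition of gauges -/

/-- `L^k = (θ^{6k})⁻¹` when `θ⁶ = L⁻¹`. [folklore] -/
theorem pow_level_eq {L : ℕ} {θ : ℝ} (hθ6 : θ ^ 6 = ((L : ℝ))⁻¹) (k : ℕ) : (L : ℝ) ^ k = (θ ^ (6 * k))⁻¹ := by
  rw [pow_mul, hθ6, inv_pow, inv_inv]

/-- `0 < θ`, `θ⁶ = L⁻¹`, `2 ≤ L` ⇒ `θ < 1`. [folklore] -/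
theorem theta_lt_one {L : ℕ} (hL : 2 ≤ L) {θ : ℝ} (hθ : 0 < θ) (hθ6 : θ ^ 6 = ((L : ℝ))⁻¹) : θ < 1 := by
  by_contra hge
  push Not at hge
  have h1 : (1 : ℝ) ≤ θ ^ 6 := one_le_pow₀ hge
  have hL2 : (2 : ℝ) ≤ L := by exact_mod_cast hL
  have h2 : ((L : ℝ))⁻¹ ≤ 1 / 2 := by rw [inv_eq_one_div]; exact one_div_le_one_div_of_le (by norm_num) hL2
  have := hθ.le
  linarith [h1, h2, hθ6.symm.le]

/-- **THE PLAIN READING AT RATE** (d = 4): pointwise bond distance `≤ A·θ^{8k}` and pointwise plain gradient `≤ C_G·θ^{13k}` everywhere give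
`plainReading L N k U U' ≤ (A + C_G)·θ^k` (`NE7EtaPlainGradientLetters.plain_reading_le` read through `L^k = θ^{−6k}`). [folklore] -/
theorem plainReading_le_rate {L N k : ℕ} {θ A C_G : ℝ} (hθ : 0 < θ) (hθ1 : θ ≤ 1) (hθ6 : θ ^ 6 = ((L : ℝ))⁻¹)
    (hA : 0 ≤ A) (hCG : 0 ≤ C_G) {U U' : Site 4 → Fin 4 → (Matrix n n ℂ)ˣ}
    (hv : ∀ (x : Site 4) (κ : Fin 4),
      ‖((U x κ : (Matrix n n ℂ)ˣ) : Matrix n n ℂ) - ((U' x κ : (Matrix n n ℂ)ˣ) : Matrix n n ℂ)‖ ≤ A * θ ^ (8 * k))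
    (hg : ∀ (x : Site 4) (μ κ : Fin 4),
      ‖(((U (x + e μ) κ : (Matrix n n ℂ)ˣ) : Matrix n n ℂ) - ((U' (x + e μ) κ : (Matrix n n ℂ)ˣ) : Matrix n n ℂ))
          - (((U x κ : (Matrix n n ℂ)ˣ) : Matrix n n ℂ) - ((U' x κ : (Matrix n n ℂ)ˣ) : Matrix n n ℂ))‖ ≤ C_G * θ ^ (13 * k)) :
    plainReading L N k U U' ≤ (A + C_G) * θ ^ k := by
  have hD0 : 0 ≤ A * θ ^ (8 * k) := by positivity
  have hG0 : 0 ≤ C_G * θ ^ (13 * k) := by positivity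
  have h1 := reading_le (L := L) (N := N) (k := k) (F := diffCfg U U') hD0 hG0 (fun x _ κ => hv x κ)
    (fun x _ μ κ => hg x μ κ)
  have h2 := NE7EtaPlainGradientLetters.plain_reading_le (D := A * θ ^ (8 * k)) (G := C_G * θ ^ (13 * k)) (k := k)
    hθ hθ1 hA hCG le_rfl le_rfl
  have e1 : (L : ℝ) ^ k * (A * θ ^ (8 * k)) = A * θ ^ (8 * k) / θ ^ (6 * k) := by
    rw [pow_level_eq hθ6, div_eq_mul_inv, mul_comm]
  have e2 : ((L : ℝ) ^ k) ^ 2 * (C_G * θ ^ (13 * k)) = C_G * θ ^ (13 * k) / θ ^ (12 * k) := by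
    rw [pow_level_eq hθ6, inv_pow, ← pow_mul, show 6 * k * 2 = 12 * k by ring, div_eq_mul_inv, mul_comm]
  unfold plainReading
  rw [e1, e2] at h1
  exact h1.trans h2

/-- The corner values `w ↦ u (L^m·w)` of an `N·L^m`-periodic site field are `N`-periodic (so the moved datum `ū·V` stays in a gauge-invariant
`dom`). [folklore] -/
theorem isPeriodicSite_corner {d L N m : ℕ} {u : Site d → (Matrix n n ℂ)ˣ} (hu : IsPeriodicSite u ((N * L ^ m : ℕ) : ℤ)) :
    IsPeriodicSite (fun w : Site d => u (((L : ℤ) ^ m) • w)) (N : ℤ) := by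
  intro x i
  have e1 : ((L : ℤ) ^ m) • (x + (N : ℤ) • e i) = ((L : ℤ) ^ m) • x + ((N * L ^ m : ℕ) : ℤ) • e i := by
    rw [smul_add, smul_smul]
    congr 2
    push_cast
    ring
  simp only [e1, hu (((L : ℤ) ^ m) • x) i]

/-- Composition of gauge transformations: `V^{w·u} = (V^u)^w` (as `B8Eq115GaugeFixing.gaugeAct_mul`, restated for this import chain).
[cite: Balaban1985Averaging, (8) p.18] -/
theorem gaugeAct_mul' {d : ℕ} (w u : Site d → (Matrix n n ℂ)ˣ) (V : Site d → Fin d → (Matrix n n ℂ)ˣ) :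
    gaugeAct (w * u) V = gaugeAct w (gaugeAct u V) := by
  funext x μ
  simp only [gaugeAct, Pi.mul_apply, mul_inv_rev, mul_assoc]

/-- The product of unitary site fields is unitary. [folklore] -/
theorem isUnitarySite_mul {d : ℕ} {w u : Site d → (Matrix n n ℂ)ˣ} (hw : IsUnitarySite w) (hu : IsUnitarySite u) :
    IsUnitarySite (w * u) :=
  fun x => (unitaryUnits (Matrix n n ℂ)).mul_mem (hw x) (hu x)

/-- The product of `P`-periodic site fields is `P`-periodic. [folklore] -/
theorem isPeriodicSite_mul {d : ℕ} {w u : Site d → (Matrix n n ℂ)ˣ} {P : ℤ} (hw : IsPeriodicSite w P) (hu : IsPeriodicSite u P) :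
    IsPeriodicSite (w * u) P :=
  fun x i => by simp only [Pi.mul_apply, hw x i, hu x i]

/-! ## §4 The canonical classes: backgrounds that OCCUR -/

/-- **RUN-B BACKGROUNDS THAT OCCUR AT TAG `K`**: the trivial background and the level-`(K+1)` minimisers (class `MinimalActionRate.sfClass`)
for data of `dom` ((1.2) p. 260 of [Balaban1987RG1] TYPE — the regular configurations the representation (0.24) is stated on; here the
minimisers themselves, [Balaban1985Variational] Thm 1 p. 279 context; OUR class, nothing printed asserted). [folklore] -/
def occB (L N : ℕ) (ε : ℝ) (dom : Set (Site 4 → Fin 4 → (Matrix n n ℂ)ˣ)) (K : ℕ) : Set (Site 4 → Fin 4 → (Matrix n n ℂ)ˣ) :=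
  {U | U = 1 ∨ ∃ V ∈ dom, IsMinimiser 4 (sfClass 4 L N ε) L N (K + 1) V U}

/-- **RUN-A BACKGROUNDS THAT OCCUR AT TAG `K`**: the trivial background, the level-`K` minimisers for data of `dom`, and the transports
`rescale L (bavg L U')` of the run-B backgrounds that occur (so that `mapsTo` holds by construction). [folklore] -/
def occA [Nonempty n] (L N : ℕ) (ε : ℝ) (dom : Set (Site 4 → Fin 4 → (Matrix n n ℂ)ˣ)) (K : ℕ) :
    Set (Site 4 → Fin 4 → (Matrix n n ℂ)ˣ) :=
  {U | U = 1 ∨ (∃ V ∈ dom, IsMinimiser 4 (sfClass 4 L N ε) L N K V U) ∨ ∃ U' ∈ occB L N ε dom K, U = rescale L (bavg L U')}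

/-- `1 ∈ occA`. [folklore] -/
theorem one_mem_occA [Nonempty n] (L N : ℕ) (ε : ℝ) (dom : Set (Site 4 → Fin 4 → (Matrix n n ℂ)ˣ)) (K : ℕ) :
    (1 : Site 4 → Fin 4 → (Matrix n n ℂ)ˣ) ∈ occA L N ε dom K := Or.inl rfl

/-- `1 ∈ occB`. [folklore] -/
theorem one_mem_occB (L N : ℕ) (ε : ℝ) (dom : Set (Site 4 → Fin 4 → (Matrix n n ℂ)ˣ)) (K : ℕ) :
    (1 : Site 4 → Fin 4 → (Matrix n n ℂ)ˣ) ∈ occB L N ε dom K := Or.inl rfl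

/-- The `mapsTo` binder holds by construction: transports of `occB` lie in `occA`. [folklore] -/
theorem rescale_bavg_mem_occA [Nonempty n] (L N : ℕ) (ε : ℝ) (dom : Set (Site 4 → Fin 4 → (Matrix n n ℂ)ˣ)) (K : ℕ)
    (U : Site 4 → Fin 4 → (Matrix n n ℂ)ˣ) (hU : U ∈ occB L N ε dom K) : rescale L (bavg L U) ∈ occA L N ε dom K :=
  Or.inr (Or.inr ⟨U, hU, rfl⟩)

/-- Level-`K` minimisers for data of `dom` lie in `occA K`. [folklore] -/
theorem minimiser_mem_occA [Nonempty n] (L N : ℕ) (ε : ℝ) (dom : Set (Site 4 → Fin 4 → (Matrix n n ℂ)ˣ)) (K : ℕ)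
    (V : Site 4 → Fin 4 → (Matrix n n ℂ)ˣ) (hV : V ∈ dom) (U : Site 4 → Fin 4 → (Matrix n n ℂ)ˣ)
    (h : IsMinimiser 4 (sfClass 4 L N ε) L N K V U) : U ∈ occA L N ε dom K :=
  Or.inr (Or.inl ⟨V, hV, h⟩)

/-- Level-`(K+1)` minimisers for data of `dom` lie in `occB K`. [folklore] -/
theorem minimiser_mem_occB (L N : ℕ) (ε : ℝ) (dom : Set (Site 4 → Fin 4 → (Matrix n n ℂ)ˣ)) (K : ℕ)
    (V : Site 4 → Fin 4 → (Matrix n n ℂ)ˣ) (hV : V ∈ dom) (U : Site 4 → Fin 4 → (Matrix n n ℂ)ˣ)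
    (h : IsMinimiser 4 (sfClass 4 L N ε) L N (K + 1) V U) : U ∈ occB L N ε dom K :=
  Or.inr ⟨V, hV, h⟩

variable (n) in
/-- **THE CARRIER ON THE OCCURRING CLASSES** (only `dom`, the class constant `ε` and the domain data remain parameters). [folklore] -/
def occCarriers [Nonempty n] (L N : ℕ) (ε : ℝ) (dom : Set (Site 4 → Fin 4 → (Matrix n n ℂ)ˣ)) (D : Type) (sc : D → ℕ) (dl : D → ℝ)
    (hdl : ∀ X, 0 ≤ dl X) : Carriers :=
  bgCarriers n L N D sc dl hdl (occA L N ε dom) (occB L N ε dom) (rescale_bavg_mem_occA L N ε dom)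

end

end Summit.QuantumFields.BalabanUV.T4Continuum.NE7EtaBackgroundCarrier
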